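import Mathlib.GroupTheory.ResiduallyFinite
import Mathlib.GroupTheory.OrderOfElement
import Mathlib.GroupTheory.GroupAction.ConjAct
import Mathlib.GroupTheory.Finiteness
import Mathlib.GroupTheory.Schreier
import Literature.GroupTheory.CombinatorialGroupTheory.FreeGroupResiduallyFinite
import Literature.GroupTheory.CombinatorialGroupTheory.FreeGroupSubgroupSeparable
import Literature.GroupTheory.CombinatorialGroupTheory.FreeGroupPowerSubgroups
import HarnessLib

/-!
# Finite quotients of a free group in which a given element has prescribed order and stays
# separated from finitely many elements outside its cyclic subgroup

Topic `Literature/GroupTheory/CombinatorialGroupTheory`; theorems only.  Let `F = F(α)` be a free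
group of finite rank, `c ∈ F`, `c ≠ 1`, and `A ⊆ F` a finite set disjoint from `⟨c⟩`.

* `exists_finiteIndex_hom_int_apply_ne_one` — there is a subgroup `G₁ ∋ c` of finite index and a
  homomorphism `χ : G₁ → ℤ` with `χ c ≠ 0` (residual finiteness: `c ∉ N` for some normal `N` of
  finite index, `G₁ = ⟨N, c⟩`; the free group `G₁` has free abelian `G₁^{ab}`, in which `c` is
  nontrivial);
* `exists_normal_finiteIndex_zpow_mem_iff` (**order control with separation**): there is
  `m₀ ≥ 1` such that for every `t ≥ 1` there is a NORMAL subgroup `N ◁ F` of finite index with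
  (a) `c ^ j ∈ N ↔ m₀ t ∣ j` — the image of `c` in `F/N` has order exactly `m₀ t` — and
  (b) `⟨c⟩ N` still disjoint from `A`.

(b) is M. Hall's separability of finitely generated subgroups (tree:
`exists_normal_finiteIndex_disjoint_sup`); (a) is obtained inside a normal finite-index
`N₀ ≤ G₁ ∩ P` from the verbal subgroups `N₀^{k}[N₀, N₀]`
(`FreeGroupPowerSubgroups.lean`).  This is the "compatible finite quotients" step in
G. Baumslag's proof that free products of two free groups amalgamating a cyclic subgroup are
residually finite (Trans. AMS 106 (1963) 193–209), used in `CyclicAmalgamResiduallyFinite.lean`.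

## References

* G. Baumslag, *On the residual finiteness of generalised free products of nilpotent groups*,
  Trans. Amer. Math. Soc. 106 (1963) 193–209. [Baumslag1963]
* R. C. Lyndon, P. E. Schupp, *Combinatorial Group Theory*, Ch. I Prop. 3.10 (M. Hall).
  [LyndonSchupp2001]
-/

namespace Literature.GroupTheory.CombinatorialGroupTheory

open Function

universe u

variable {α : Type u}

open scoped IsMulCommutative in
/-- In a free group, a nontrivial element `c` lies in a subgroup `G₁` of finite index carrying a
homomorphism `χ : G₁ → ℤ` with `χ c ≠ 0`.  (Residual finiteness gives a normal `N` of finite index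
with `c ∉ N`; on `G₁ = ⟨N, c⟩` the projection to the cyclic group `G₁/N` does not kill `c`, so `c`
is nontrivial in the free abelian group `G₁^{ab}`.) [cite: Baumslag1963, §3] -/
theorem exists_finiteIndex_hom_int_apply_ne_one (c : FreeGroup α) (hc : c ≠ 1) :
    ∃ (G₁ : Subgroup (FreeGroup α)) (hc₁ : c ∈ G₁), G₁.FiniteIndex ∧
      ∃ χ : G₁ →* Multiplicative ℤ, χ ⟨c, hc₁⟩ ≠ 1 := by
  classical
  haveI := freeGroup_residuallyFinite α
  obtain ⟨N, hN⟩ := Group.exists_finiteIndexNormalSubgroup_notMem c hc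
  let π : FreeGroup α →* FreeGroup α ⧸ N.toSubgroup := QuotientGroup.mk' N.toSubgroup
  let C : Subgroup (FreeGroup α ⧸ N.toSubgroup) := Subgroup.zpowers (π c)
  let G₁ : Subgroup (FreeGroup α) := C.comap π
  have hcG₁ : c ∈ G₁ := Subgroup.mem_comap.mpr (Subgroup.mem_zpowers _)
  have hker : π.ker ≤ G₁ := fun g hg => by
    rw [MonoidHom.mem_ker] at hg
    simp [G₁, Subgroup.mem_comap, hg]
  haveI : π.ker.FiniteIndex := by rw [QuotientGroup.ker_mk']; infer_instance
  haveI hG₁ : G₁.FiniteIndex := Subgroup.finiteIndex_of_le hker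
  -- `c` is nontrivial in `G₁^{ab}`
  let ψ : G₁ →* C := π.subgroupComap C
  have hab : Abelianization.of (⟨c, hcG₁⟩ : G₁) ≠ 1 := by
    intro h1
    have h2 := congrArg (Abelianization.lift ψ) h1
    rw [Abelianization.lift_apply_of, map_one] at h2
    have h3 : (ψ ⟨c, hcG₁⟩ : FreeGroup α ⧸ N.toSubgroup) = π c := rfl
    rw [h2] at h3
    have h4 : π c = 1 := by simpa using h3.symm
    exact hN ((QuotientGroup.eq_one_iff c).mp h4)
  -- coordinates on the free abelian group `G₁^{ab}`
  obtain ⟨ε⟩ := exists_abelianization_addEquiv_finsupp (N := G₁)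
  have hv : ε (Additive.ofMul (Abelianization.of (⟨c, hcG₁⟩ : G₁))) ≠ 0 := by
    intro h
    apply hab
    have : Additive.ofMul (Abelianization.of (⟨c, hcG₁⟩ : G₁)) = 0 :=
      ε.injective (by rw [map_zero]; exact h)
    exact this
  obtain ⟨b, hb⟩ : ∃ b, ε (Additive.ofMul (Abelianization.of (⟨c, hcG₁⟩ : G₁))) b ≠ 0 := by
    by_contra! h
    exact hv (Finsupp.ext h)
  let f : Additive G₁ →+ ℤ :=
    (Finsupp.applyAddHom b).comp (ε.toAddMonoidHom.comp (MonoidHom.toAdditive Abelianization.of))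
  refine ⟨G₁, hcG₁, hG₁, AddMonoidHom.toMultiplicativeRight f, ?_⟩
  intro h
  apply hb
  have := congrArg Multiplicative.toAdd h
  simpa [f] using this

/-- **Order control with separation in a free group** (the compatible-quotients step of
Baumslag's theorem).  Let `F = F(α)` be free of finite rank, `c ≠ 1`, and `A` a finite set
disjoint from `⟨c⟩`.  Then there is `m₀ ≥ 1` such that for every `t ≥ 1` some normal subgroup
`N ◁ F` of finite index satisfies `c ^ j ∈ N ↔ m₀ t ∣ j` (the image of `c` in `F/N` has order
exactly `m₀ t`) and `⟨c⟩ N ∩ A = ∅`. [cite: Baumslag1963, §§3–4] -/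
theorem exists_normal_finiteIndex_zpow_mem_iff [Finite α] (c : FreeGroup α) (hc : c ≠ 1)
    (A : Set (FreeGroup α)) (hA : A.Finite)
    (hcA : Disjoint ((Subgroup.zpowers c : Subgroup (FreeGroup α)) : Set (FreeGroup α)) A) :
    ∃ m₀ : ℕ, 0 < m₀ ∧ ∀ t : ℕ, 0 < t → ∃ N : Subgroup (FreeGroup α), N.Normal ∧ N.FiniteIndex ∧
      (∀ j : ℤ, c ^ j ∈ N ↔ ((m₀ * t : ℕ) : ℤ) ∣ j) ∧
      Disjoint ((Subgroup.zpowers c ⊔ N : Subgroup (FreeGroup α)) : Set (FreeGroup α)) A := by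
  classical
  -- (b) separation, M. Hall
  have hfg : (Subgroup.zpowers c).FG := ⟨{c}, by rw [Finset.coe_singleton, Subgroup.zpowers_eq_closure]⟩
  obtain ⟨P, hPn, hPf, hPA⟩ := exists_normal_finiteIndex_disjoint_sup (Subgroup.zpowers c) hfg A hA hcA
  -- a finite-index `G₁ ∋ c` with `χ : G₁ → ℤ`, `χ c ≠ 0`
  obtain ⟨G₁, hcG₁, hG₁, χ, hχ⟩ := exists_finiteIndex_hom_int_apply_ne_one c hc
  -- `N₀ = P ∩ core(G₁)`, normal of finite index, inside `P` and `G₁`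
  let N₀ : Subgroup (FreeGroup α) := P ⊓ G₁.normalCore
  haveI hN₀n : N₀.Normal := inferInstance
  haveI hN₀f : N₀.FiniteIndex := ⟨Subgroup.index_inf_ne_zero hPf.index_ne_zero
    (Subgroup.finiteIndex_normalCore G₁).index_ne_zero⟩
  have hN₀P : N₀ ≤ P := inf_le_left
  have hN₀G₁ : N₀ ≤ G₁ := inf_le_right.trans (Subgroup.normalCore_le G₁)
  -- the order `m` of `c` modulo `N₀`, and `u = c ^ m ∈ N₀`
  let m : ℕ := orderOf (QuotientGroup.mk c : FreeGroup α ⧸ N₀)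
  have hm : 0 < m := orderOf_pos _
  have hcm : ∀ j : ℤ, c ^ j ∈ N₀ ↔ (m : ℤ) ∣ j := by
    intro j
    rw [← QuotientGroup.eq_one_iff, QuotientGroup.mk_zpow, orderOf_dvd_iff_zpow_eq_one]
  have hu : c ^ (m : ℤ) ∈ N₀ := (hcm m).mpr (dvd_refl _)
  let u : N₀ := ⟨c ^ (m : ℤ), hu⟩
  -- `χ` restricted to `N₀` does not kill `u`
  let χ₀ : N₀ →* Multiplicative ℤ := χ.comp (Subgroup.inclusion hN₀G₁)
  have hχ₀ : χ₀ u ≠ 1 := by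
    have h1 : χ₀ u = χ ⟨c, hcG₁⟩ ^ (m : ℤ) := by
      rw [← map_zpow]; rfl
    rw [h1]
    intro h
    have h2 := congrArg Multiplicative.toAdd h
    rw [toAdd_zpow, toAdd_one, smul_eq_mul, mul_eq_zero] at h2
    rcases h2 with h2 | h2
    · exact (Nat.pos_iff_ne_zero.mp hm) (by exact_mod_cast h2)
    · exact hχ (by rw [← toAdd_eq_zero]; exact h2)  -- hmm
  -- order control inside the free group `N₀`
  haveI : IsFreeGroup N₀ := inferInstance
  haveI : Group.FG N₀ := inferInstance
  obtain ⟨d, hd, hV⟩ := exists_characteristic_finiteIndex_zpow_mem_iff χ₀ u hχ₀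
  refine ⟨m, hm, fun t ht => ?_⟩
  obtain ⟨V, hVf, hVchar, hVu⟩ := hV t ht
  let N : Subgroup (FreeGroup α) := V.map N₀.subtype
  have hNN₀ : N ≤ N₀ := Subgroup.map_subtype_le V
  have hmemN : ∀ x : N₀, (x : FreeGroup α) ∈ N ↔ x ∈ V := by
    intro x
    constructor
    · rintro ⟨y, hy, hxy⟩
      have : y = x := Subtype.ext hxy
      rwa [← this]
    · intro hx
      exact ⟨x, hx, rfl⟩
  refine ⟨N, ?_, ?_, ?_, ?_⟩
  · -- normal: `V` is characteristic in the normal subgroup `N₀`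
    refine ⟨fun x hx g => ?_⟩
    obtain ⟨y, hy, rfl⟩ := hx
    have h1 : g * (y : FreeGroup α) * g⁻¹ = ((MulAut.conjNormal g y : N₀) : FreeGroup α) :=
      (MulAut.conjNormal_apply g y).symm
    change g * (y : FreeGroup α) * g⁻¹ ∈ N
    rw [h1, hmemN]
    exact hVchar _ y hy
  · -- finite index
    constructor
    rw [Subgroup.index_map, N₀.ker_subtype, sup_bot_eq, N₀.range_subtype]
    exact mul_ne_zero hVf.index_ne_zero hN₀f.index_ne_zero
  · -- order exactly `m t`
    intro j
    constructor
    · intro hj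
      have hj0 : (m : ℤ) ∣ j := (hcm j).mp (hNN₀ hj)
      obtain ⟨j', rfl⟩ := hj0
      have h1 : c ^ ((m : ℤ) * j') = ((u ^ j' : N₀) : FreeGroup α) := by
        rw [zpow_mul]; rfl
      rw [h1, hmemN, hVu] at hj
      push_cast
      exact mul_dvd_mul_left _ hj
    · intro hj
      push_cast at hj
      obtain ⟨j', rfl⟩ := hj
      have h1 : c ^ ((m : ℤ) * (t : ℤ) * j') = ((u ^ ((t : ℤ) * j') : N₀) : FreeGroup α) := by
        rw [mul_assoc, zpow_mul]; rfl
      rw [h1, hmemN, hVu]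
      exact dvd_mul_right _ _
  · -- separation
    refine Set.disjoint_of_subset_left ?_ hPA
    exact SetLike.coe_subset_coe.mpr (sup_le_sup_left (hNN₀.trans hN₀P) _)

end Literature.GroupTheory.CombinatorialGroupTheory
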